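import Summits.QuantumFields.YangMills.Theorems.LuscherReductionDressedRitzLiftLeakageForms
import Summits.QuantumFields.YangMills.Theorems.LuscherReductionRunningReductionKTPhysSpace
import Summits.QuantumFields.YangMills.Theorems.LuscherReductionDressedRitzPolyakovLiftDefs
import Summits.QuantumFields.YangMills.Theorems.FemtoTransferGapGroundState
import Summits.QuantumFields.YangMills.Theorems.FemtoTransferGapLevelsPos
import HarnessLib

/-!
# Route `LuscherReduction`, item `DressedRitz` (stmt-QuantumFields-20205), line «polyakovlift» r6, stub S-PSCAL″ — PREP (F9 groundwork, LEAD prover g2):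
# raw vacua are `±` the top eigenvector; first-moment VACUUM/QUASIMODE CONCENTRATION; the energy form `P(x) = λ₀‖x‖² − ⟨x,K x⟩` controls the residual

Support module (`--supports stmt-QuantumFields-20205`).  Elementary consequences of Courant–Fischer domination, first for an abstract symmetric bilinear form `ip`
and an `ip`-symmetric `K` on a real vector space (continuing s1's `LiftLeak` toolkit), then on the physical subspace of ANY lattice size `L` (`ip = l2Form L`,
`K = transferOp β`); the one-site S-PSCAL″ assembly (`R6-DESIGN.md` §3 (b),(f)) uses them at `L := 1`, `β := 2L³/Λ³`:

* `top_split` (abstract) / `top_split_phys` — for `x` with `θ‖x‖² ≤ ⟨x,Kx⟩`, `θ > λ₁` (`λ₁` dominating `e₀^⊥`): `x = a·e₀ + η`, `η ⊥ e₀`,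
  `‖x‖² = a² + ‖η‖²`, `⟨x,Kx⟩ = λ₀a² + ⟨η,Kη⟩`, `(θ − λ₁)‖η‖² ≤ (λ₀ − θ)a²`, `P(η) = P(x) ≤ (λ₀ − θ)‖x‖²`;
* ★ `residual_sq_le` (abstract) / `residual_sq_le_phys` — `‖λ₀x − Kx‖² ≤ λ₀ · P(x)` (`K² ≤ λ₀K`, s1's `LiftLeak.form_sq_le_dom`);
* `energy_cs` (abstract) / `energy_cs_phys` — Cauchy–Schwarz `P(x,y)² ≤ P(x)P(y)`;
* ★ `rawVacuum_eq_smul` — a raw vacuum `φ` (`IsRawVacuum β φ`) IS `±e₀` POINTWISE for any normalised physical top eigenfunction `e₀` dominating its orthocomplement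
  at `λ₁ < λ₀` (simplicity of the top level, tree `levelValue_one_lt_levelValue_zero`).

HONEST FRAMING: fixed-lattice Rayleigh-quotient plumbing (conditional femto rung R2b1); nothing here bears on infinite volume, the continuum limit or the Clay gap.
References: Reed–Simon IV, Thm. XIII.1 [cite: ReedSimonIV1978, Thm. XIII.1]; T. Kato (1949) §1 [cite: Kato1949, §1].
-/

set_option autoImplicit false

noncomputable section

open MeasureTheory Filter Topology Real
open Literature.MathematicalPhysics.QuantumFieldTheory (GaugeConfig Site gaugeTransform)
open scoped BigOperators

namespace Summit.QuantumFields.YangMills.Theorems.FemtoTransferGap.PScal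

open Summit.QuantumFields.YangMills.Theorems.FemtoTransferGap
open Summit.QuantumFields.YangMills.Theorems.FemtoTransferGap.PolyakovLift (IsRawVacuum)

/-! ## §1 Abstract: one symmetric form `ip`, one `ip`-symmetric `K`, one unit top eigenvector `e₀` -/

section Abstract

variable {D : Type*} [AddCommGroup D] [Module ℝ D]

/-- **Top split (algebra).**  `ip` symmetric, `K` `ip`-symmetric, `ip(e₀,e₀) = 1`, `K e₀ = λ₀ e₀`; `a := ip(x,e₀)`, `η := x − a·e₀`: then `ip(η,e₀) = 0`,
`ip(x,x) = a² + ip(η,η)` and `ip(x,Kx) = λ₀a² + ip(η,Kη)`. [folklore] -/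
theorem top_split (ip : D →ₗ[ℝ] D →ₗ[ℝ] ℝ) (hip : ∀ x y, ip x y = ip y x) (K : D →ₗ[ℝ] D) (hK : ∀ x y, ip (K x) y = ip x (K y))
    {e₀ : D} (hn : ip e₀ e₀ = 1) {l0 : ℝ} (heig : K e₀ = l0 • e₀) (x : D) :
    ip (x - ip x e₀ • e₀) e₀ = 0 ∧
      ip x x = ip x e₀ ^ 2 + ip (x - ip x e₀ • e₀) (x - ip x e₀ • e₀) ∧
      ip x (K x) = l0 * ip x e₀ ^ 2 + ip (x - ip x e₀ • e₀) (K (x - ip x e₀ • e₀)) := by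
  have h1 : ip e₀ x = ip x e₀ := hip _ _
  have h2 : ip e₀ (K x) = l0 * ip x e₀ := by rw [← hK, heig, map_smul, LinearMap.smul_apply, smul_eq_mul, h1]
  have h3 : ip x (K e₀) = l0 * ip x e₀ := by rw [heig, map_smul, smul_eq_mul]
  have h4 : ip e₀ (K e₀) = l0 := by rw [heig, map_smul, smul_eq_mul, hn, mul_one]
  refine ⟨?_, ?_, ?_⟩
  · simp only [map_sub, map_smul, LinearMap.sub_apply, LinearMap.smul_apply, smul_eq_mul, hn]; ring
  · simp only [map_sub, map_smul, LinearMap.sub_apply, LinearMap.smul_apply, smul_eq_mul, hn, h1]; ring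
  · simp only [map_sub, map_smul, LinearMap.sub_apply, LinearMap.smul_apply, smul_eq_mul, h2, h3, h4]; ring

/-- **Top split (inequalities).**  In the setting of `top_split`, if `ip(y,Ky) ≤ λ₁ ip(y,y)` whenever `ip(y,e₀) = 0` and `θ·ip(x,x) ≤ ip(x,Kx)`, then
`(θ − λ₁)·ip(η,η) ≤ (λ₀ − θ)·a²` and `λ₀ ip(η,η) − ip(η,Kη) = λ₀ ip(x,x) − ip(x,Kx) ≤ (λ₀ − θ) ip(x,x)`. [cite: ReedSimonIV1978, Thm. XIII.1] -/
theorem top_split_le (ip : D →ₗ[ℝ] D →ₗ[ℝ] ℝ) (hip : ∀ x y, ip x y = ip y x) (K : D →ₗ[ℝ] D) (hK : ∀ x y, ip (K x) y = ip x (K y))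
    {e₀ : D} (hn : ip e₀ e₀ = 1) {l0 l1 θ : ℝ} (heig : K e₀ = l0 • e₀) (hdom : ∀ y, ip y e₀ = 0 → ip y (K y) ≤ l1 * ip y y)
    (x : D) (hθ : θ * ip x x ≤ ip x (K x)) :
    (θ - l1) * ip (x - ip x e₀ • e₀) (x - ip x e₀ • e₀) ≤ (l0 - θ) * ip x e₀ ^ 2 ∧
      l0 * ip (x - ip x e₀ • e₀) (x - ip x e₀ • e₀) - ip (x - ip x e₀ • e₀) (K (x - ip x e₀ • e₀)) = l0 * ip x x - ip x (K x) ∧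
      l0 * ip x x - ip x (K x) ≤ (l0 - θ) * ip x x := by
  obtain ⟨hηe, hnorm, hform⟩ := top_split ip hip K hK hn heig x
  have hη := hdom _ hηe
  refine ⟨?_, ?_, ?_⟩
  · rw [hnorm, hform] at hθ; nlinarith
  · rw [hnorm, hform]; ring
  · nlinarith

/-- ★ **`ip(λ₀x − Kx, λ₀x − Kx) ≤ λ₀·(λ₀ ip(x,x) − ip(x,Kx))`** when `0 ≤ ip(y,Ky) ≤ λ₀ ip(y,y)` for all `y` (`K² ≤ λ₀K`). [cite: Kato1949, §1] -/
theorem residual_sq_le (ip : D →ₗ[ℝ] D →ₗ[ℝ] ℝ) (hip : ∀ x y, ip x y = ip y x) (hip0 : ∀ y, 0 ≤ ip y y) (K : D →ₗ[ℝ] D)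
    (hK : ∀ x y, ip (K x) y = ip x (K y)) (hpos : ∀ y, 0 ≤ ip y (K y)) {l0 : ℝ} (hl0 : 0 ≤ l0) (hdom : ∀ y, ip y (K y) ≤ l0 * ip y y) (x : D) :
    ip (l0 • x - K x) (l0 • x - K x) ≤ l0 * (l0 * ip x x - ip x (K x)) := by
  have h1 := LiftLeak.form_sq_le_dom ip hip hip0 K hK hpos (fun _ => True) (fun _ _ => trivial) hl0 (fun y _ => hdom y) (r := x) trivial
  have hKx : ip (K x) x = ip x (K x) := hip _ _
  have hexp : ip (l0 • x - K x) (l0 • x - K x) = l0 ^ 2 * ip x x - 2 * l0 * ip x (K x) + ip (K x) (K x) := by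
    simp only [map_sub, map_smul, LinearMap.sub_apply, LinearMap.smul_apply, smul_eq_mul, hKx]; ring
  rw [hexp]; nlinarith [h1]

/-- Cauchy–Schwarz for the energy form `P(x,y) = λ₀ ip(x,y) − ip(x,Ky)`: `P(x,y)² ≤ P(x,x)·P(y,y)` when `ip(y,Ky) ≤ λ₀ ip(y,y)` for all `y`. [folklore] -/
theorem energy_cs (ip : D →ₗ[ℝ] D →ₗ[ℝ] ℝ) (hip : ∀ x y, ip x y = ip y x) (K : D →ₗ[ℝ] D) (hK : ∀ x y, ip (K x) y = ip x (K y))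
    {l0 : ℝ} (hdom : ∀ y, ip y (K y) ≤ l0 * ip y y) (x y : D) :
    (l0 * ip x y - ip x (K y)) ^ 2 ≤ (l0 * ip x x - ip x (K x)) * (l0 * ip y y - ip y (K y)) := by
  let P : D →ₗ[ℝ] D →ₗ[ℝ] ℝ := l0 • ip - ip.compl₂ K
  have hP : ∀ a b : D, P a b = l0 * ip a b - ip a (K b) := fun a b => by
    simp only [P, LinearMap.sub_apply, LinearMap.smul_apply, LinearMap.compl₂_apply, smul_eq_mul]
  have hsymm : ∀ a b : D, P a b = P b a := fun a b => by rw [hP, hP, hip a b, ← hK, hip (K a) b]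
  have hposP : ∀ a : D, 0 ≤ P a a := fun a => by rw [hP]; linarith [hdom a]
  have h := LiftLeak.bilin_sq_le P hsymm hposP x y
  simpa only [hP] using h

end Abstract

/-! ## §2 The physical subspace of the `(ℤ/L)³` model -/

variable {L : ℕ} [NeZero L]

/-- Dictionary: `⟨ψ, K φ⟩ = qform ψ φ` for physical representatives. [folklore] -/
theorem l2_transferApply_eq_qform (β : ℝ) (ψ φ : GaugeConfig 3 L SU2 → ℝ) : l2 ψ (transferApply β φ) = qform su2Rep β ψ φ :=
  (qform_eq_l2_transferApply β ψ φ).symm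

/-- ★ **`‖λ₀x − Kx‖² ≤ λ₀·(λ₀‖x‖² − ⟨x,Kx⟩)`** for physical `x`, `β ≥ 0`, given domination at `k = 0`. [cite: Kato1949, §1] -/
theorem residual_sq_le_phys {β : ℝ} (hβ : 0 ≤ β)
    (hdom0 : ∀ ψ : GaugeConfig 3 L SU2 → ℝ, IsPhys ψ → qform su2Rep β ψ ψ ≤ levelValue su2Rep L β 0 * l2 ψ ψ)
    {x : GaugeConfig 3 L SU2 → ℝ} (hx : IsPhys x) :
    l2 (levelValue su2Rep L β 0 • x - transferApply β x) (levelValue su2Rep L β 0 • x - transferApply β x) ≤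
      levelValue su2Rep L β 0 * (levelValue su2Rep L β 0 * l2 x x - qform su2Rep β x x) := by
  have h := residual_sq_le (l2Form L) l2Form_symm l2Form_self_nonneg (transferOp β) (transferOp_symm β)
    (l2Form_self_transferOp_nonneg hβ) (levelValue_su2Rep_nonneg L hβ 0)
    (fun y => by rw [l2Form_transferOp_right, l2Form_apply]; exact hdom0 _ (isPhys_coe y)) ⟨x, hx⟩
  simpa only [l2Form_apply, Submodule.coe_sub, Submodule.coe_smul, coe_transferOp, l2_transferApply_eq_qform] using h

/-- ★ Cauchy–Schwarz for the energy form on physical vectors. [folklore] -/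
theorem energy_cs_phys (β : ℝ) (hdom0 : ∀ ψ : GaugeConfig 3 L SU2 → ℝ, IsPhys ψ → qform su2Rep β ψ ψ ≤ levelValue su2Rep L β 0 * l2 ψ ψ)
    {x y : GaugeConfig 3 L SU2 → ℝ} (hx : IsPhys x) (hy : IsPhys y) :
    (levelValue su2Rep L β 0 * l2 x y - qform su2Rep β x y) ^ 2 ≤
      (levelValue su2Rep L β 0 * l2 x x - qform su2Rep β x x) * (levelValue su2Rep L β 0 * l2 y y - qform su2Rep β y y) := by
  have h := energy_cs (l2Form L) l2Form_symm (transferOp β) (transferOp_symm β)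
    (fun z => by rw [l2Form_transferOp_right, l2Form_apply]; exact hdom0 _ (isPhys_coe z)) ⟨x, hx⟩ ⟨y, hy⟩
  simpa only [l2Form_apply, coe_transferOp, l2_transferApply_eq_qform] using h

/-- ★ **Top split on the physical subspace.**  `x, e₀` physical, `‖e₀‖ = 1`, `K e₀ = λ₀ e₀`, domination of `e₀^⊥` at `λ₁`, `θ‖x‖² ≤ ⟨x,Kx⟩`; with
`a = ⟨x,e₀⟩`, `η = x − a·e₀`: `η ⊥ e₀`, `‖x‖² = a² + ‖η‖²`, `⟨x,Kx⟩ = λ₀a² + ⟨η,Kη⟩`, `(θ − λ₁)‖η‖² ≤ (λ₀ − θ)a²`,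
`P(η) = P(x) ≤ (λ₀ − θ)‖x‖²`. [cite: ReedSimonIV1978, Thm. XIII.1] -/
theorem top_split_phys (β : ℝ) {x e₀ : GaugeConfig 3 L SU2 → ℝ} (hx : IsPhys x) (he₀ : IsPhys e₀) (hn : l2 e₀ e₀ = 1)
    (heig : transferApply β e₀ = levelValue su2Rep L β 0 • e₀) {lam1 θ : ℝ}
    (hdom : ∀ ψ : GaugeConfig 3 L SU2 → ℝ, IsPhys ψ → l2 ψ e₀ = 0 → qform su2Rep β ψ ψ ≤ lam1 * l2 ψ ψ) (hθ : θ * l2 x x ≤ qform su2Rep β x x) :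
    l2 (x - l2 x e₀ • e₀) e₀ = 0 ∧
      l2 x x = l2 x e₀ ^ 2 + l2 (x - l2 x e₀ • e₀) (x - l2 x e₀ • e₀) ∧
      qform su2Rep β x x = levelValue su2Rep L β 0 * l2 x e₀ ^ 2 + qform su2Rep β (x - l2 x e₀ • e₀) (x - l2 x e₀ • e₀) ∧
      (θ - lam1) * l2 (x - l2 x e₀ • e₀) (x - l2 x e₀ • e₀) ≤ (levelValue su2Rep L β 0 - θ) * l2 x e₀ ^ 2 ∧
      levelValue su2Rep L β 0 * l2 (x - l2 x e₀ • e₀) (x - l2 x e₀ • e₀) - qform su2Rep β (x - l2 x e₀ • e₀) (x - l2 x e₀ • e₀) =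
        levelValue su2Rep L β 0 * l2 x x - qform su2Rep β x x ∧
      levelValue su2Rep L β 0 * l2 x x - qform su2Rep β x x ≤ (levelValue su2Rep L β 0 - θ) * l2 x x := by
  have heig' : transferOp β ⟨e₀, he₀⟩ = levelValue su2Rep L β 0 • (⟨e₀, he₀⟩ : physSubmodule L) :=
    Subtype.ext (by rw [coe_transferOp, Submodule.coe_smul]; exact heig)
  have hn' : l2Form L ⟨e₀, he₀⟩ ⟨e₀, he₀⟩ = 1 := hn
  have hdom' : ∀ y : physSubmodule L, l2Form L y ⟨e₀, he₀⟩ = 0 → l2Form L y (transferOp β y) ≤ lam1 * l2Form L y y := fun y hy => by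
    rw [l2Form_transferOp_right, l2Form_apply]; exact hdom _ (isPhys_coe y) hy
  have hθ' : θ * l2Form L ⟨x, hx⟩ ⟨x, hx⟩ ≤ l2Form L ⟨x, hx⟩ (transferOp β ⟨x, hx⟩) := by
    rw [l2Form_transferOp_right, l2Form_apply]; exact hθ
  obtain ⟨h1, h2, h3⟩ := top_split (l2Form L) l2Form_symm (transferOp β) (transferOp_symm β) hn' heig' ⟨x, hx⟩
  obtain ⟨h4, h5, h6⟩ := top_split_le (l2Form L) l2Form_symm (transferOp β) (transferOp_symm β) hn' heig' hdom' ⟨x, hx⟩ hθ'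
  simp only [l2Form_apply, Submodule.coe_sub, Submodule.coe_smul, coe_transferOp, l2_transferApply_eq_qform] at h1 h2 h3 h4 h5 h6
  exact ⟨h1, h2, h3, h4, h5, h6⟩

/-! ## §3 ★ Raw vacua are `±` the top eigenvector -/

/-- A physical function with `⟨u,u⟩ = 0` vanishes a.e. [folklore] -/
theorem ae_eq_zero_of_l2_self_eq_zero {u : GaugeConfig 3 L SU2 → ℝ} (hu : IsPhys u) (h0 : l2 u u = 0) :
    u =ᵐ[configMeasure SU2 L] 0 := by
  have hint : Integrable (fun U => u U * u U) (configMeasure SU2 L) := by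
    have h := (PhysL2.memLp_two_of_isPhys hu).integrable_sq
    simpa [sq] using h
  have h := (integral_eq_zero_iff_of_nonneg (fun U => mul_self_nonneg (u U)) hint).1 h0
  filter_upwards [h] with U hU
  simpa using mul_self_eq_zero.1 hU

/-- `K` of an a.e.-zero function is `0`. [folklore] -/
theorem transferApply_eq_zero_of_ae {β : ℝ} {u : GaugeConfig 3 L SU2 → ℝ} (h : u =ᵐ[configMeasure SU2 L] 0) : transferApply β u = 0 := by
  rw [PhysL2.transferApply_congr_ae h]
  funext U
  simp [transferApply_apply]

/-- ★ **A raw vacuum is `±e₀`, pointwise.**  `φ` raw vacuum (`K φ = λ₀ φ`, `‖φ‖ = 1`), `e₀` physical normalised with `K e₀ = λ₀ e₀`, domination of `e₀^⊥` at a level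
`λ₁ < λ₀` ⟹ `φ = ⟨φ,e₀⟩·e₀` everywhere and `⟨φ,e₀⟩² = 1`. [cite: ReedSimonIV1978, Thm. XIII.1] -/
theorem rawVacuum_eq_smul {β : ℝ} (hβ : 0 < β) {φ e₀ : GaugeConfig 3 L SU2 → ℝ} (hφ : IsRawVacuum β φ) (he₀ : IsPhys e₀) (hn : l2 e₀ e₀ = 1)
    (heig : transferApply β e₀ = levelValue su2Rep L β 0 • e₀) {lam1 : ℝ} (hlam1 : lam1 < levelValue su2Rep L β 0)
    (hdom : ∀ ψ : GaugeConfig 3 L SU2 → ℝ, IsPhys ψ → l2 ψ e₀ = 0 → qform su2Rep β ψ ψ ≤ lam1 * l2 ψ ψ) :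
    φ = l2 φ e₀ • e₀ ∧ l2 φ e₀ ^ 2 = 1 := by
  obtain ⟨hφP, hφn, hφeig⟩ := hφ
  set l0 := levelValue su2Rep L β 0 with hl0
  have hθ : l0 * l2 φ φ ≤ qform su2Rep β φ φ := by
    rw [qform_eq_l2_transferApply, hφeig, l2_comm φ (l0 • φ), l2_smul_left]
  obtain ⟨hηe, hnorm, -, hle, -, -⟩ := top_split_phys β hφP he₀ hn heig hdom hθ
  set a := l2 φ e₀ with ha
  set u : GaugeConfig 3 L SU2 → ℝ := φ - a • e₀ with hu
  have huP : IsPhys u := by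
    have h := ((⟨φ, hφP⟩ : physSubmodule L) - a • (⟨e₀, he₀⟩ : physSubmodule L)).2
    exact h
  have hu0 : l2 u u = 0 := by
    have hnn := l2_self_nonneg u
    have h' := hle
    rw [sub_self, zero_mul] at h'
    nlinarith
  have hKu : transferApply β u = l0 • u := by
    have hlin : transferApply β u = transferApply β φ - a • transferApply β e₀ := by
      have := congrArg (fun z : physSubmodule L => (z : GaugeConfig 3 L SU2 → ℝ))
        (map_sub (transferOp β) ⟨φ, hφP⟩ (a • ⟨e₀, he₀⟩))
      simpa only [map_smul, coe_transferOp, Submodule.coe_sub, Submodule.coe_smul] using this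
    rw [hlin, hφeig, heig, hu, smul_sub, smul_smul, smul_smul, mul_comm]
  have hK0 : transferApply β u = 0 := transferApply_eq_zero_of_ae (ae_eq_zero_of_l2_self_eq_zero huP hu0)
  have hupt : u = 0 := by
    have : l0 • u = 0 := by rw [← hKu, hK0]
    exact (smul_eq_zero.1 this).resolve_left (levelValue_su2Rep_pos (L := L) hβ 0).ne'
  have hφeq : φ = a • e₀ := by rw [← sub_eq_zero]; exact hupt
  refine ⟨hφeq, ?_⟩
  have h2 : l2 u u = l2 φ φ - a ^ 2 := by rw [hnorm]; ring
  rw [hu0, hφn] at h2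
  linarith

end Summit.QuantumFields.YangMills.Theorems.FemtoTransferGap.PScal

end
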